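import Mathlib.Data.ZMod.Basic
import Mathlib.Data.Fintype.Pi
import Mathlib.Algebra.Group.Even
import Mathlib.Algebra.QuadraticAlgebra.Basic
import Mathlib.Tactic.NormNum
import Mathlib.Tactic.NormNum.Prime
import HarnessLib

/-!
# Venture HSemireg — THEOREM 35-C «NO PRODUCT OF LOCAL SIGNS»: the sign-pattern parity lemma and the `det 561` witness data
# (ENGINE-W PROBE5 §35 (4)) — kernel combinatorics

HONEST FRAMING. Lean index of the computation cell `pub-hsemireg`, widening group ENGINE-W (code A, seat `engine-w-1`,
gen 17). FINITE COMBINATORICS of sign functions on `{±1}³` and modular arithmetic in `ℤ∕561`; no abelian variety, sheaf, `Ext`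
group, secant structure or semiregularity map is constructed; nothing here says that HC, HC_CM or HC_AV holds. Theorems only
(0 `def`, 0 named fact, 0 `sorry`). New namespace `LocalSigns`.

SOURCE (the cell's own result): `widen/ENGINE-W/out/probe5/PROBE5-STIZ-A.md` §35 (4) (v4.1, engine-w-1 g10), **THEOREM 35-C** as
printed: «(NO «PRODUCT OF LOCAL SIGNS» …). Any rule of the form «`Λ_X(H; A, N) ≅ SEED ⟺ ∏_{ℓ | d} ε_ℓ(H, 𝔤_ℓ) = +1`» with arbitrary
`H`-dependent local factors `ε_ℓ(H, ·) ∈ {±1}` on the two candidates `{𝔓_ℓ^{e}, σ𝔓_ℓ^{e}}` forces, together with `class(𝔤) =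
class(σ𝔤)` (35-B), an EVEN number of `𝓔`-orbits among the `2^{ω(d′)−1}` σ-orbits of targets when `ω(d′) = 3` [`f(s) = ∏e_ℓ(s_ℓ)`,
`f(s) = f(−s)` ⟹ `∏_ℓ e_ℓ(+)e_ℓ(−) = 1`, and the product of `f` over the four orbits `{+++}, {++−}, {+−+}, {−++}` equals
`∏_ℓ e_ℓ(+)³e_ℓ(−) = ∏_ℓ e_ℓ(+)e_ℓ(−) = +1`]. **At `d = 561 = 3·11·17` (targets `A ≡ ±41, ±58, ±146, ±245 mod 561`; four σ-orbits)
the non-real form `H = [[8, −7−5ω],[−7−5ω̄, 75]]` is REACHED at `±41, ±58, ±245` and NEVER at `±146` — pattern `S S E S`, ONE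
`𝓔`-orbit**», and 35-B: «The residues `A mod d` with `A² ≡ −2` number `2^{ω(d′)}`». What the kernel holds (signs as `Bool`, `true` =
`−1` ∕ `𝓔`, product of signs = `xor`):

* §1 **`even_number_of_negative_orbits`** — for ANY three local sign functions `e₁ e₂ e₃ : Bool → Bool`, the number of orbit
  representatives `s = (+, s₂, s₃)` with `f(s) = e₁(+) ⊕ e₂(s₂) ⊕ e₃(s₃) = −1` is EVEN (`decide` over the `4³ × 4` cases) — so a
  single `𝓔`-orbit among four (pattern `S S E S`) is impossible for every product-of-local-signs rule; `orbit_invariance` records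
  that `f(s) = f(−s)` for all `s` iff `e₁(+)e₁(−)·e₂(+)e₂(−)·e₃(+)e₃(−) = +1` (the bracketed first step).
* §2 **the `det 561` data**: `det_561` (`8·75 − N(7 + 5ω) = 561`, `N(a + bω) = a² − ab + b²`), `factor_561` (`561 = 3·11·17`,
  `ω(d′) = 3`), `roots_561` (`41² ≡ 58² ≡ 146² ≡ 245² ≡ −2 (mod 561)`) and **`card_roots_561`** (exactly `8 = 2³` residues `A` with
  `A² ≡ −2 (mod 561)`: the four σ-orbits `{±41}, {±58}, {±146}, {±245}`), `one_E_orbit_is_odd` (`¬ Even 1`).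
WHAT IS NOT HERE: the classes `SEED ∕ 𝓔`, THEOREM 35-A's decisions at the eight cells (machine ×2 across methods inside code A per
§35 (4); ×2 across codes at det 561 per v4.1d), THEOREM 35-B itself.
-/

namespace Summit.Ventures.HSemireg.LocalSigns

/-! ## §1 The parity lemma for three local signs -/

/-- **The bracketed step of 35-C**: for local sign functions `e₁ e₂ e₃ : {±} → {±}` (as `Bool → Bool`, `true` = `−1`, product =
`xor`), the rule `f(s₁,s₂,s₃) = e₁(s₁)·e₂(s₂)·e₃(s₃)` takes the value `−1` on an EVEN number of the four σ-orbit representatives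
`(+,+,+), (+,+,−), (+,−,+), (+,−,−)` — whatever the `e_ℓ` («forces … an EVEN number of `𝓔`-orbits among the `2^{ω(d′)−1}` σ-orbits
of targets when `ω(d′) = 3`»). [kernel, `decide`] -/
theorem even_number_of_negative_orbits :
    ∀ e₁ e₂ e₃ : Bool → Bool,
      Even ((Finset.univ.filter fun s : Bool × Bool =>
        (xor (e₁ false) (xor (e₂ s.1) (e₃ s.2))) = true).card) := by
  decide

/-- The well-definedness clause «`f(s) = f(−s)` ⟹ `∏_ℓ e_ℓ(+)e_ℓ(−) = 1`» (and conversely): `f` is constant on σ-orbits `{s, −s}`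
iff the product of the six local values is `+1`. [kernel, `decide`] -/
theorem orbit_invariance :
    ∀ e₁ e₂ e₃ : Bool → Bool,
      (∀ s₁ s₂ s₃ : Bool,
          xor (e₁ s₁) (xor (e₂ s₂) (e₃ s₃)) = xor (e₁ (!s₁)) (xor (e₂ (!s₂)) (e₃ (!s₃))))
        ↔ xor (xor (e₁ false) (e₁ true)) (xor (xor (e₂ false) (e₂ true)) (xor (e₃ false) (e₃ true))) = false := by
  decide

/-- … so the observed pattern «`S S E S`, ONE `𝓔`-orbit» is not of sign type: `1` is odd. [kernel] -/
theorem one_E_orbit_is_odd : ¬ Even (1 : ℕ) := by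
  decide

/-! ## §2 The `det 561` witness data -/

open QuadraticAlgebra in
/-- `det [[8, −7−5ω],[−7−5ω̄, 75]] = 8·75 − N(7 + 5ω) = 600 − 39 = 561`, with `N(a + bω) = a² − ab + b²`; in `ℤ[ω] = QuadraticAlgebra ℤ
(−1) (−1)`: `8·75 − (7 + 5ω)·(7 + 5ω)‾ = 561`. [kernel] -/
theorem det_561 : (8 * 75 - (7 ^ 2 - 7 * 5 + 5 ^ 2) : ℤ) = 561 ∧
    (8 * 75 : QuadraticAlgebra ℤ (-1) (-1)) - ⟨7, 5⟩ * star (⟨7, 5⟩ : QuadraticAlgebra ℤ (-1) (-1)) = 561 := by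
  refine ⟨by norm_num, ?_⟩
  ext <;> simp [QuadraticAlgebra.star_mk]

/-- `561 = 3·11·17` — three odd primes, `ω(d′) = 3`, `2^{ω(d′)−1} = 4` σ-orbits. [kernel, `decide`] -/
theorem factor_561 : (561 : ℕ) = 3 * 11 * 17 ∧ Nat.Prime 3 ∧ Nat.Prime 11 ∧ Nat.Prime 17 ∧ 2 ^ (3 - 1) = 4 := by
  refine ⟨by norm_num, by norm_num, by norm_num, by norm_num, by norm_num⟩

/-- «targets `A ≡ ±41, ±58, ±146, ±245 mod 561`»: `A² ≡ −2 (mod 561)` for `A = 41, 58, 146, 245`. [kernel, `decide`] -/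
theorem roots_561 :
    (41 : ZMod 561) ^ 2 = -2 ∧ (58 : ZMod 561) ^ 2 = -2 ∧ (146 : ZMod 561) ^ 2 = -2 ∧ (245 : ZMod 561) ^ 2 = -2 := by
  decide

/-- **«The residues `A mod d` with `A² ≡ −2` number `2^{ω(d′)}`»** at `d = 561`: exactly `8 = 2³` classes `A ∈ ℤ∕561` satisfy
`A² = −2` (namely `±41, ±58, ±146, ±245`). [kernel, `decide`] -/
theorem card_roots_561 : (Finset.univ.filter fun A : ZMod 561 => A ^ 2 = -2).card = 8 := by
  decide +kernel

/-- The eight roots listed: the solution set is exactly `{41, 520, 58, 503, 146, 415, 245, 316}` (`520 = −41`, `503 = −58`, `415 = −146`,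
`316 = −245` in `ℤ∕561`). [kernel, `decide`] -/
theorem roots_561_list :
    (Finset.univ.filter fun A : ZMod 561 => A ^ 2 = -2) = {41, 520, 58, 503, 146, 415, 245, 316} := by
  decide +kernel

end Summit.Ventures.HSemireg.LocalSigns
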